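import Literature.NumberTheory.LFunctions.Zhang2022.NumericsSection15AppB

/-!
# Zhang (2022) Appendix B (B.3): the `e″_{1j}` fork in the `α₁ = α log T` reading (row N-09, α₁ lineage)

Trunk T-ANT (NumberTheory/LFunctions). Y. Zhang, *Discrete mean estimates and the Landau–Siegel
zero*, arXiv:2211.02515v1 [Zhang2022LandauSiegel], Lemma 15.1 [pp. 86–87] and the proof of (B.3)
[Appendix B, p.108, tex L5317–L5334].

`NumericsSection15AppB` refutes the closing "□" of the proof of (B.3) in the banked reading
`α₁ = α𝓛` (`Numerics.not_StepB_u015c`) and records the inconsistency of the printed chain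
(`Numerics.appB3_chain_inconsistent`). The typed file `TypedAppendixB` also carries the chain in the
cell's reading of record `α₁ = α·log T = α𝓛^{1.1}` (`Typed.AppendixB.EqB_3R`, `StepB_u015aR`,
`StepB_u015bR`, `StepB_u015cR`), each a WEAKER statement than its banked form (larger error), whose
docstring notes that the refutation "applies verbatim … since `α₁ → 0` as well" — this file supplies
the two kernel theorems:

* `not_StepB_u015cR : ∀ c′, ¬ StepB_u015cR c′` — at `j = 1` the last display of the proof is
  `(1 − 5c′α𝓛)·e″₁₁(derived)` (`Numerics.valueB15_one_eq`), at distance `> 3.8·10⁻⁵ − O(α𝓛)` from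
  `e″₁₁(stated)` (`e1pp_delta_one_norm_bounds`), while the allowed error is `C·α₁ ≤ Cπ/𝓛 → 0` along
  the primes (`alpha1_le_pi_div_ell`);
* `appB3R_chain_inconsistent : ∀ c′, ¬ (EqB_3R c′ ∧ StepB_u015aR c′ ∧ StepB_u015bR c′)` — (B.3) with
  the STATED `e″_{1j}` cannot be obtained from the two steps its printed proof supports, in the `α₁`
  reading either (at `l₁ = 1` the three would put `valueB15` within `O(α₁)` of `e″(stated)`).

What the same two steps DO give is (B.3) with the DERIVED constant `AppendixB.e1ppD`
(`AppendixBVarrho.tailB3_sub_e1ppD_of`). Status of the source: an unrefereed manuscript under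
adjudication; nothing here is a claim about Theorems 1–2 of the manuscript.
-/

noncomputable section

open Complex Real

namespace Literature.NumberTheory.LFunctions.Zhang2022.Numerics

open Literature.NumberTheory.LFunctions.Zhang2022

/-! ### Sizes of `α₁ = α·log T` -/

/-- `α₁ = α𝓛^{1.1} ≥ 0` for every `D` (`α = π/𝓛⁹`, `𝓛 = log D ≥ 0`). [cite: Zhang2022LandauSiegel, §6 p. 12] -/
theorem alpha1_nonneg (D : ℕ) : 0 ≤ Skeleton.alpha1 D := by
  have hℓ : 0 ≤ Skeleton.ell D := Real.log_natCast_nonneg D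
  rw [Skeleton.alpha1, Skeleton.log_bigT, Skeleton.alpha, Skeleton.log_bigP]
  exact mul_nonneg (div_nonneg Real.pi_pos.le (pow_nonneg hℓ 9)) (Real.rpow_nonneg hℓ _)

/-- `α₁ > 0` for `D ≥ 3`. [cite: Zhang2022LandauSiegel, §6 p. 12] -/
theorem alpha1_pos {D : ℕ} (hD : 3 ≤ D) : 0 < Skeleton.alpha1 D := by
  have hℓ : 0 < Skeleton.ell D := by linarith [Skeleton.one_lt_ell hD]
  rw [Skeleton.alpha1, Skeleton.log_bigT]
  exact mul_pos (alpha_pos' hD) (Real.rpow_pos_of_pos hℓ _)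

/-- `α₁ = π𝓛^{−7.9} ≤ π/𝓛` for `D ≥ 3`: the error `O(α₁)` of the reading of record tends to `0`.
[cite: Zhang2022LandauSiegel, §6 p. 12] -/
theorem alpha1_le_pi_div_ell {D : ℕ} (hD : 3 ≤ D) :
    Skeleton.alpha1 D ≤ π / Skeleton.ell D := by
  have h1 : 1 < Skeleton.ell D := Skeleton.one_lt_ell hD
  have hℓ : 0 < Skeleton.ell D := by linarith
  have hα : 0 < Skeleton.alpha D := alpha_pos' hD
  have h9 := alpha_mul_ell9 hD
  have h3 : Skeleton.ell D ^ (1.1 : ℝ) ≤ Skeleton.ell D ^ (3 : ℝ) :=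
    Real.rpow_le_rpow_of_exponent_le h1.le (by norm_num)
  have h3' : Skeleton.ell D ^ (3 : ℝ) = Skeleton.ell D ^ (3 : ℕ) := by
    rw [show (3 : ℝ) = ((3 : ℕ) : ℝ) by norm_num, Real.rpow_natCast]
  rw [Skeleton.alpha1, Skeleton.log_bigT, le_div_iff₀ hℓ]
  have h49 : Skeleton.ell D ^ 4 ≤ Skeleton.ell D ^ 9 := pow_le_pow_right₀ h1.le (by norm_num)
  calc Skeleton.alpha D * Skeleton.ell D ^ (1.1 : ℝ) * Skeleton.ell D
      ≤ Skeleton.alpha D * Skeleton.ell D ^ (3 : ℕ) * Skeleton.ell D := by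
        rw [← h3']; gcongr
    _ = Skeleton.alpha D * Skeleton.ell D ^ 4 := by ring
    _ ≤ Skeleton.alpha D * Skeleton.ell D ^ 9 := mul_le_mul_of_nonneg_left h49 hα.le
    _ = π := h9

/-! ### The refutation and the inconsistency of the printed chain, `α₁` reading -/

/-- **REFUTED: the closing "□" of the proof of (B.3), reading of record `α₁ = α log T`** [Z22 p.108,
tex L5333–5334] — for every (2.13) constant `c′`, `¬ Typed.AppendixB.StepB_u015cR c′`: at `j = 1` the
proof's last display is `(1 − 5c′α𝓛)e″₁₁(derived)` (`valueB15_one_eq`), at distance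
`> 3.8·10⁻⁵ − 5|c′|α𝓛·6·10⁻⁵` from `e″₁₁(stated)`, while the allowed error `Cα₁ ≤ Cπ/𝓛 → 0` along the
primes. Class: printed-false-pointwise (the misprinted closed form of `e″_{1j}`); immaterial to
(18.2)/(2.32) (`n09_ineq182_all_readings`). [cite: Zhang2022LandauSiegel, Appendix B (B.3), p.108] -/
theorem not_StepB_u015cR (c' : ℝ) : ¬ Typed.AppendixB.StepB_u015cR c' := by
  rintro ⟨C, hC⟩
  set M : ℝ := |C| + 5 * |c'| * 0.00006 + 1 with hM
  have hM0 : 0 < M := by positivity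
  set K : ℝ := π * M / 0.000019 with hK
  have hK0 : 0 < K := by positivity
  obtain ⟨p, hpN, hp3, _inst, _χ, hS⟩ := ForAllLarge.at_large_prime hC ⌈Real.exp K⌉₊
  have h1 : 1 < Skeleton.ell p := Skeleton.one_lt_ell hp3
  have hℓ : 0 < Skeleton.ell p := by linarith
  have hα : 0 < Skeleton.alpha p := alpha_pos' hp3
  have hα1 : 0 < Skeleton.alpha1 p := alpha1_pos hp3
  have hKℓ : K ≤ Skeleton.ell p := by
    have hp' : Real.exp K ≤ p := (Nat.le_ceil _).trans (by exact_mod_cast hpN)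
    have := Real.log_le_log (Real.exp_pos K) hp'
    rwa [Real.log_exp] at this
  have hα1ℓ : Skeleton.alpha1 p ≤ π / Skeleton.ell p := alpha1_le_pi_div_ell hp3
  have hα1K : Skeleton.alpha1 p * M ≤ 0.000019 := by
    have h2 : π / Skeleton.ell p ≤ π / K := div_le_div_of_nonneg_left Real.pi_pos.le hK0 hKℓ
    have h3 : π / K = 0.000019 / M := by rw [hK]; field_simp
    have h4 : Skeleton.alpha1 p * M ≤ 0.000019 / M * M :=
      mul_le_mul_of_nonneg_right (hα1ℓ.trans (h2.trans h3.le)) hM0.le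
    have h5 : 0.000019 / M * M = 0.000019 := by field_simp
    linarith
  have hαℓ1 : Skeleton.alpha p * Skeleton.ell p ≤ Skeleton.alpha1 p :=
    Skeleton.alpha_mul_ell_le_alpha1 hp3
  have hj := hS 1 (by simp)
  rw [valueB15_one_eq c' hp3] at hj
  set a : ℂ := e1ppD 1 - e1ppj 1 with ha
  set b : ℂ := ((-(5 * c' * Skeleton.alpha p * Skeleton.ell p) : ℝ) : ℂ) * e1ppD 1 with hb
  have hsum : ((1 - 5 * c' * Skeleton.alpha p * Skeleton.ell p : ℝ) : ℂ) * e1ppD 1 - e1ppj 1 = a + b := by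
    rw [ha, hb]; push_cast; ring
  rw [hsum] at hj
  have hΔ := e1pp_delta_one_norm_bounds
  have ha' : ‖a‖ = ‖e1ppj 1 - e1ppD 1‖ := by rw [ha, norm_sub_rev]
  have hbn : ‖b‖ = 5 * |c'| * (Skeleton.alpha p * Skeleton.ell p) * ‖e1ppD 1‖ := by
    rw [hb, norm_mul, Complex.norm_real, Real.norm_eq_abs, abs_neg]
    have h5 : |(5:ℝ) * c' * Skeleton.alpha p * Skeleton.ell p|
        = 5 * |c'| * (Skeleton.alpha p * Skeleton.ell p) := by
      rw [abs_mul, abs_mul, abs_mul, abs_of_pos hα, abs_of_pos hℓ, abs_of_pos (by norm_num : (0:ℝ) < 5)]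
      ring
    rw [h5]
  have htri : ‖a‖ ≤ ‖a + b‖ + ‖b‖ := by
    calc ‖a‖ = ‖(a + b) - b‖ := by ring_nf
      _ ≤ ‖a + b‖ + ‖b‖ := norm_sub_le _ _
  have hbsmall : ‖b‖ ≤ 5 * |c'| * 0.00006 * Skeleton.alpha1 p := by
    rw [hbn]
    have := norm_e1ppD_one_lt
    have hc : 0 ≤ 5 * |c'| * (Skeleton.alpha p * Skeleton.ell p) := by positivity
    have hc' : 0 ≤ 5 * |c'| * 0.00006 := by positivity
    nlinarith [mul_le_mul_of_nonneg_left hαℓ1 hc']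
  have hCle : C * Skeleton.alpha1 p ≤ |C| * Skeleton.alpha1 p :=
    mul_le_mul_of_nonneg_right (le_abs_self C) hα1.le
  nlinarith [hΔ.1, hj, htri, hbsmall, hCle, hα1K, hα1, ha']

/-- **The printed proof of (B.3) is internally inconsistent in the `α₁ = α log T` reading too**:
(B.3) with the STATED `e″_{1j}` (`EqB_3R`), its penultimate step (`StepB_u015aR`: tail `≈` the double
integral) and its last display (`StepB_u015bR`: double integral `≈ valueB15`) cannot all hold, for any
`c′` — at `l₁ = 1` they would put `valueB15` within `O(α₁)` of `e″(stated)`, against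
`not_StepB_u015cR`. The two steps instead give (B.3) with the DERIVED constant
(`AppendixBVarrho.tailB3_sub_e1ppD_of`). [cite: Zhang2022LandauSiegel, Appendix B (B.3), p.108] -/
theorem appB3R_chain_inconsistent (c' : ℝ) :
    ¬ (Typed.AppendixB.EqB_3R c' ∧ Typed.AppendixB.StepB_u015aR c' ∧
        Typed.AppendixB.StepB_u015bR c') := by
  rintro ⟨⟨C₁, h₁⟩, ⟨C₂, h₂⟩, ⟨C₃, h₃⟩⟩
  apply not_StepB_u015cR c'
  refine ⟨|C₁| + |C₂| + |C₃|, ?_⟩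
  have h3le : Skeleton.ForAllLarge fun D _ _ => 3 ≤ D :=
    Skeleton.ForAllLarge.of_le 3 fun D _ _ hD _ _ => hD
  refine (((h₁.and h₂).and h₃).and h3le).mono ?_
  intro D _ χ _ _ ⟨⟨⟨k₁, k₂⟩, k₃⟩, hD⟩ j hj
  -- the side conditions at `l₁ = 1`
  have hn : (1 : ℕ) ∈ Skeleton.nset (Skeleton.frakq D) :=
    ⟨Nat.one_pos, fun q hq hq1 => (hq.not_dvd_one hq1).elim⟩
  have hT : ((1 : ℕ) : ℝ) < Skeleton.bigT D := by
    have hℓ : 0 < Skeleton.ell D := by linarith [Skeleton.one_lt_ell hD]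
    rw [Nat.cast_one, Skeleton.bigT]
    exact Real.one_lt_exp_iff.mpr (Real.rpow_pos_of_pos hℓ _)
  have e₁ := k₁ j hj 1 le_rfl hn hT
  have e₂ := k₂ j hj 1 le_rfl hn hT
  have e₃ := k₃ j hj 1 le_rfl hn hT
  have hα1 := alpha1_nonneg D
  set V := Typed.AppendixB.valueB15 c' D j
  set Dd := Typed.AppendixB.doubleB15 c' D j 1
  set T := Typed.AppendixB.tailB3 c' D j 1
  have key : ‖V - e1ppj j‖ ≤ ‖Dd - V‖ + ‖T - Dd‖ + ‖T - e1ppj j‖ := by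
    have hVE : V - e1ppj j = (-(Dd - V) + -(T - Dd)) + (T - e1ppj j) := by ring
    calc ‖V - e1ppj j‖ = ‖(-(Dd - V) + -(T - Dd)) + (T - e1ppj j)‖ := by rw [hVE]
      _ ≤ ‖-(Dd - V) + -(T - Dd)‖ + ‖T - e1ppj j‖ := norm_add_le _ _
      _ ≤ (‖-(Dd - V)‖ + ‖-(T - Dd)‖) + ‖T - e1ppj j‖ := by
          gcongr; exact norm_add_le _ _
      _ = ‖Dd - V‖ + ‖T - Dd‖ + ‖T - e1ppj j‖ := by rw [norm_neg, norm_neg]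
  have hC₁ : C₁ * Skeleton.alpha1 D ≤ |C₁| * Skeleton.alpha1 D :=
    mul_le_mul_of_nonneg_right (le_abs_self _) hα1
  have hC₂ : C₂ * Skeleton.alpha1 D ≤ |C₂| * Skeleton.alpha1 D :=
    mul_le_mul_of_nonneg_right (le_abs_self _) hα1
  have hC₃ : C₃ * Skeleton.alpha1 D ≤ |C₃| * Skeleton.alpha1 D :=
    mul_le_mul_of_nonneg_right (le_abs_self _) hα1
  nlinarith [key, e₁, e₂, e₃, hC₁, hC₂, hC₃]

/-- Corollary for the discharge lane: the edge `AppendixBVarrho.eqB_3R_of : StepB_u015aR → StepB_u015bR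
→ StepB_u015cR → EqB_3R` has an unsatisfiable third premise, so (B.3) with the STATED `e″_{1j}` is not
reachable through it, for any `c′`. [cite: Zhang2022LandauSiegel, Appendix B (B.3), p.108] -/
theorem eqB_3R_of_premise_false (c' : ℝ) :
    ¬ (Typed.AppendixB.StepB_u015aR c' ∧ Typed.AppendixB.StepB_u015bR c' ∧
        Typed.AppendixB.StepB_u015cR c') :=
  fun h => not_StepB_u015cR c' h.2.2

end Literature.NumberTheory.LFunctions.Zhang2022.Numerics
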